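import Summits.QuantumFields.BalabanUV.Gaps.EndDrawdownBand

/-!
# Gaps / EndBandStructure — FORCED ∕ POSSIBLE as predicates of the one-loop sequence ALONE: both quantified readings of the END statement over
# the remainder class `[−rlo, rhi]` (`EndDrawdownBand.EndForcedLU` ∕ `EndPossibleLU`) are UP-SETS in the one-loop sequence, BOX-independent,
# and INSENSITIVE TO ANY FINITE SET OF ONE-LOOP COEFFICIENTS — **THE CAP IS END-IRRELEVANT AT THE QUANTIFIED LEVEL**; a divergent one-loop
# part is forced; WHERE THE BOUNDED-ABOVE LETTER WENT: in the class «`β⁰` bounded above» ⟺ the printed uniform upper bound (U), and (U) is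
# INDEPENDENT of the END statement over realization classes (one class with E everywhere and (U) nowhere, one with (U) everywhere and E
# nowhere); readings for constant and convergent one-loop parts (strict thresholds), and: at the boundary, FORCED is not a function of the
# limit.  A PORT into the tree, with attribution, of g1-plan-2 GEN 23–25's HOME kernel `HOME/g1/skeletons/B12Thm2SubDag_plan2.lean` v1.15
# (sha16 6167da52388d3b3c) §12a ∕ §13c ∕ §13e ∕ §14f, one-sided-first (cell pub-balaban-gaps, seat g1-p3 GEN 8, rows CAP ∕ tail «split ∕
# weakening»; file 4 of «the one-loop interface of the END statement»)

HONEST FRAMING (cell rule, page 1 of everything): corollaries of `EndDrawdownBand`'s two threshold theorems and `EndDrawdownSeq`'s sequence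
calculus; hypothesis SHAPES; `EndForcedLU` ∕ `EndPossibleLU` are quantified READINGS of the cell's END-grade statement `EndpointExistence`
over Bałaban-free data `(b, rlo, rhi, γ₀)` — not binders, not nodes.  For Bałaban's β the upper bound (U) is PRINTED UNIFORMLY ([I] §1 p. 264)
and (0.31) as printed reads every coefficient: the gain is in the SHAPE of the END-grade statement (one node, no side condition on `β⁰`, the CAP
provably END-irrelevant), NOT in any discharge — words ∕ odds of record UNCHANGED.  AUTHORSHIP: mathematics g1-plan-2 GEN 23–25's (planner seat;
«g1-p3 ports with attribution»); this seat: one-sided-first restatement, the corollaries marked (this seat), header, docstrings, re-check.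
Nothing of Bałaban's asserted; nothing certified (NODE-O instance 0∕1, CAP coefficients certified 0); 0∕6 binders; one finite T⁴; NOT [I] Thm 2,
NOT `BetaPertH`, NOT the continuum limit, NOT Clay.

CITATION HEADER (tags CONTEXT ONLY).  [I] = T. Bałaban, Commun. Math. Phys. **109** (1987) 249–301 [Balaban1987RG1]: Thm 2 p. 259 (first sentence;
(0.31)), §1 p. 264 («uniformly bounded»), (2.12)–(2.14) p. 268.
-/

namespace Summit.QuantumFields.BalabanUV.Gaps.EndBandStructure

open Literature.MathematicalPhysics.QuantumFieldTheory.Balaban1983to89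
open Literature.MathematicalPhysics.QuantumFieldTheory.Balaban1983to89.FlowStep
open Literature.MathematicalPhysics.QuantumFieldTheory.Balaban1983to89.FlowStepRuns
open Literature.MathematicalPhysics.QuantumFieldTheory.Balaban1983to89.DagBinding
open Literature.MathematicalPhysics.QuantumFieldTheory.Balaban1983to89.Beta.RemainderChain (RemainderConst)
open Summit.QuantumFields.BalabanUV.Gaps.EndDrawdownSeq
open Summit.QuantumFields.BalabanUV.Gaps.EndDrawdownBand
open Filter Topology Finset

noncomputable section

variable {β : HBeta}

/-! ## §1 FORCED ∕ POSSIBLE are predicates of `b` alone: up-sets, box-free, CAP-blind (kernel §13c, ported one-sided) -/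

/-- FORCED IS AN UP-SET IN THE ONE-LOOP SEQUENCE · `b ≤ b′` termwise ⟹ (FORCED for `b` ⟹ FORCED for `b′`) — «more one-loop asymptotic freedom never
costs endpoint existence», `b′` unbounded allowed (kernel §13c `EndForced_mono`). [cite: Balaban1987RG1, Thm 2 p.259 (first sentence)] -/
theorem endForcedLU_mono {b b' : ℕ → ℝ} {rlo rhi γ₀ : ℝ} (hγ₀ : 0 < γ₀) (hc : -rlo ≤ rhi) (hle : ∀ j, b j ≤ b' j)
    (h : EndForcedLU b rlo rhi γ₀) : EndForcedLU b' rlo rhi γ₀ :=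
  endForcedLU_of_dwSeq rhi hγ₀ (dwSeq_mono_seq hle (dwSeq_of_endForcedLU hc h))

/-- POSSIBLE IS AN UP-SET IN THE ONE-LOOP SEQUENCE (kernel §13c `EndPossible_mono`). [cite: Balaban1987RG1, Thm 2 p.259 (first sentence)] -/
theorem endPossibleLU_mono {b b' : ℕ → ℝ} {rlo rhi γ₀ : ℝ} (hγ₀ : 0 < γ₀) (hc : -rlo ≤ rhi) (hle : ∀ j, b j ≤ b' j)
    (h : EndPossibleLU b rlo rhi γ₀) : EndPossibleLU b' rlo rhi γ₀ :=
  endPossibleLU_of_dwSeq_neg hγ₀ hc (dwSeq_mono_seq hle (dwSeq_neg_of_endPossibleLU hγ₀ h))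

/-- THE BOX IS END-IRRELEVANT over the class (FORCED) (kernel §13c `EndForced_irrel_box`). [folklore] -/
theorem endForcedLU_irrel_box {b : ℕ → ℝ} {rlo rhi γ₀ γ₀' : ℝ} (hγ₀ : 0 < γ₀) (hγ₀' : 0 < γ₀') (hc : -rlo ≤ rhi) :
    EndForcedLU b rlo rhi γ₀ ↔ EndForcedLU b rlo rhi γ₀' := by
  rw [endForcedLU_iff_dwSeq hγ₀ hc, endForcedLU_iff_dwSeq hγ₀' hc]

/-- THE BOX IS END-IRRELEVANT over the class (POSSIBLE) (kernel §13c `EndPossible_irrel_box`). [folklore] -/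
theorem endPossibleLU_irrel_box {b : ℕ → ℝ} {rlo rhi γ₀ γ₀' : ℝ} (hγ₀ : 0 < γ₀) (hγ₀' : 0 < γ₀') (hc : -rlo ≤ rhi) :
    EndPossibleLU b rlo rhi γ₀ ↔ EndPossibleLU b rlo rhi γ₀' := by
  rw [endPossibleLU_iff_dwSeq_neg hγ₀ hc, endPossibleLU_iff_dwSeq_neg hγ₀' hc]

/-- **THE CAP IS END-IRRELEVANT AT THE QUANTIFIED LEVEL (FORCED)** · two one-loop sequences that agree from `k₀` on are FORCED together: NO finite set of
one-loop coefficients — in particular no CAP sign list `∀ k < k₀, 0 < β⁰_{k+1}` — is read by the END statement over the class.  Contrast: (0.31) as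
printed (the P-layer's pointwise floor) reads EVERY coefficient (kernel §13c `EndForced_of_eventuallyEq`).
[cite: Balaban1987RG1, Thm 2 p.259 (first sentence) and (2.12)–(2.14) p.268] -/
theorem endForcedLU_of_eventuallyEq {b b' : ℕ → ℝ} {rlo rhi γ₀ : ℝ} {k₀ : ℕ} (hγ₀ : 0 < γ₀) (hc : -rlo ≤ rhi)
    (heq : ∀ j, k₀ ≤ j → b' j = b j) (h : EndForcedLU b rlo rhi γ₀) : EndForcedLU b' rlo rhi γ₀ :=
  endForcedLU_of_dwSeq rhi hγ₀ (dwSeq_of_eventuallyEq heq (dwSeq_of_endForcedLU hc h))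

/-- THE CAP IS END-IRRELEVANT AT THE QUANTIFIED LEVEL (POSSIBLE) (kernel §13c `EndPossible_of_eventuallyEq`).
[cite: Balaban1987RG1, Thm 2 p.259 (first sentence) and (2.12)–(2.14) p.268] -/
theorem endPossibleLU_of_eventuallyEq {b b' : ℕ → ℝ} {rlo rhi γ₀ : ℝ} {k₀ : ℕ} (hγ₀ : 0 < γ₀) (hc : -rlo ≤ rhi)
    (heq : ∀ j, k₀ ≤ j → b' j = b j) (h : EndPossibleLU b rlo rhi γ₀) : EndPossibleLU b' rlo rhi γ₀ :=
  endPossibleLU_of_dwSeq_neg hγ₀ hc (dwSeq_of_eventuallyEq heq (dwSeq_neg_of_endPossibleLU hγ₀ h))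

/-- … as an equivalence (this seat): two one-loop sequences that agree from `k₀` on are forced over the class together or not at all. [folklore] -/
theorem endForcedLU_iff_of_eventuallyEq {b b' : ℕ → ℝ} {rlo rhi γ₀ : ℝ} {k₀ : ℕ} (hγ₀ : 0 < γ₀) (hc : -rlo ≤ rhi)
    (heq : ∀ j, k₀ ≤ j → b' j = b j) : EndForcedLU b' rlo rhi γ₀ ↔ EndForcedLU b rlo rhi γ₀ :=
  ⟨endForcedLU_of_eventuallyEq hγ₀ hc fun j hj => (heq j hj).symm, endForcedLU_of_eventuallyEq hγ₀ hc heq⟩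

/-- THE TAIL ALONE FORCES (this seat) · an EVENTUAL floor `rlo ≤ b_j` (`j ≥ k₀`) ⟹ E FORCED over `[−rlo, rhi]`, for every box, every `rhi`, and with NO
statement about `b_0, …, b_{k₀−1}` — the quantified form of `EndDrawdownBand.endpointExistence_of_eventualFloor_remainderConst`.
[cite: Balaban1987RG1, Thm 2 p.259 (first sentence) and (2.12)–(2.14) p.268] -/
theorem endForcedLU_of_eventually_ge {b : ℕ → ℝ} {rlo γ₀ : ℝ} {k₀ : ℕ} (rhi : ℝ) (hγ₀ : 0 < γ₀) (h : ∀ j, k₀ ≤ j → rlo ≤ b j) :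
    EndForcedLU b rlo rhi γ₀ :=
  endForcedLU_of_dwSeq rhi hγ₀ (dwSeq_of_eventually_ge h)

/-- A DIVERGENT one-loop part `b → +∞` is FORCED for EVERY remainder box on every box — a class no bounded-above-keyed theorem reaches
(kernel §13c `EndForced_of_tendsto_atTop`). [cite: Balaban1987RG1, Thm 2 p.259 (first sentence)] -/
theorem endForcedLU_of_tendsto_atTop {b : ℕ → ℝ} {rlo γ₀ : ℝ} (rhi : ℝ) (hγ₀ : 0 < γ₀) (hb : Tendsto b atTop atTop) :
    EndForcedLU b rlo rhi γ₀ :=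
  endForcedLU_of_dwSeq rhi hγ₀ (dwSeq_of_tendsto_atTop hb rlo)

/-- STRICTNESS WITNESS · the unbounded one-loop sequence `b_j := j` is FORCED (every remainder box, every box) — and violates «`β⁰` bounded above»
(`EndDrawdownSeq.nat_not_bddAbove`): the bounded-above letter of the kernel's v1.11 ∕ v1.12 sufficiency theorems was a genuine restriction, removed
by the per-level socket (kernel §13c `EndForced_nat`). [folklore] -/
theorem endForcedLU_nat {rlo γ₀ : ℝ} (rhi : ℝ) (hγ₀ : 0 < γ₀) : EndForcedLU (fun j : ℕ => (j : ℝ)) rlo rhi γ₀ :=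
  endForcedLU_of_tendsto_atTop rhi hγ₀ tendsto_natCast_atTop_atTop

/-! ## §2 Where the bounded-above letter went: in the class B0 ⟺ (UP), and (UP) ⟂ E (kernel §13e, ported) -/

/-- (UP) ∧ the LOWER half (Q3) ∧ `0 < γ₀` ⟹ `β⁰` bounded above: evaluate (UP) at the constant history `γ₀ ∈ Box γ₀ k`,
`β⁰_k = β_k(γ₀,…,γ₀) − β¹_k(γ₀,…,γ₀) ≤ β′ + rlo` (kernel §13e `B0_of_Up_lower`). [cite: Balaban1987RG1, §1 p.264] -/
theorem bddAbove_of_betaUpperH_lower (Sβ : B12Beta.OneLoopSplit β) {β' γ₀ rlo : ℝ} (hγ₀ : 0 < γ₀) (hup : BetaUpperH β' γ₀ β)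
    (hlo : ∀ k (p : Fin (k + 1) → ℝ), p ∈ B12Beta.HistBox γ₀ k → -rlo ≤ Sβ.β1 k p) : ∃ B : ℝ, ∀ j, Sβ.β0 j ≤ B := by
  refine ⟨β' + rlo, fun k => ?_⟩
  have hv : (fun _ : Fin (k + 1) => γ₀) ∈ Box γ₀ k := mem_box.mpr fun _ => ⟨hγ₀, le_rfl⟩
  have h1 := hup k _ hv
  have h2 := hlo k _ (histBox_of_mem_box hv)
  rw [Sβ.split k] at h1
  linarith

/-- `β⁰ ≤ B` ∧ the UPPER half (Q4) `β¹ ≤ rhi` ⟹ (UP) with `β′ := B + rhi` (kernel §11 `Up_of_B0_T2` ∕ §13e `Up_of_B0_LU`). [cite: Balaban1987RG1, §1 p.264] -/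
theorem betaUpperH_of_bddAbove_upper (Sβ : B12Beta.OneLoopSplit β) {B γ₀ rhi : ℝ} (hB : ∀ j, Sβ.β0 j ≤ B)
    (hup : ∀ k (p : Fin (k + 1) → ℝ), p ∈ B12Beta.HistBox γ₀ k → Sβ.β1 k p ≤ rhi) : BetaUpperH (B + rhi) γ₀ β := by
  intro k v hv
  have h1 := hup k v (histBox_of_mem_box hv)
  rw [Sβ.split k]
  linarith [hB k]

/-- IN THE CLASS, B0 ⟺ (UP) · over the one-sided remainder class on `]0,γ₀]` (`0 < γ₀`): `β⁰` bounded above ⟺ `∃ β′, BetaUpperH β′ γ₀ β`.  The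
bounded-above letter is EXACTLY the one-loop content of the printed upper bound (U) — a (0.31)-layer input; the END statement does not consume it
(`EndDrawdownBand.endpointExistence_of_dwSeq_remainderLU`) (kernel §13e `B0_iff_Up_LU`). [cite: Balaban1987RG1, §1 p.264] -/
theorem bddAbove_iff_betaUpperH (Sβ : B12Beta.OneLoopSplit β) {γ₀ rlo rhi : ℝ} (hγ₀ : 0 < γ₀) (hrem : RemainderLU Sβ γ₀ rlo rhi) :
    (∃ B : ℝ, ∀ j, Sβ.β0 j ≤ B) ↔ ∃ β' : ℝ, BetaUpperH β' γ₀ β :=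
  ⟨fun ⟨B, hB⟩ => ⟨B + rhi, betaUpperH_of_bddAbove_upper Sβ hB fun k p hp => (hrem k p hp).2⟩,
    fun ⟨_, hup⟩ => bddAbove_of_betaUpperH_lower Sβ hγ₀ hup fun k p hp => (hrem k p hp).1⟩

/-- **(UP) ⟂ E, FIRST HALF** · the one-loop sequence `b_j := j` with ANY remainder in `[−rlo, rhi]` on `]0,γ₀]`: E for EVERY realization, (UP) for NO
realization and no `β′` — endpoint existence WITHOUT the printed uniform upper bound, over a whole realization class (kernel §13e `End_all_Up_none_nat`).
[cite: Balaban1987RG1, Thm 2 p.259 (first sentence) and §1 p.264] -/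
theorem endForced_all_betaUpperH_none_nat {rlo rhi γ₀ : ℝ} (hγ₀ : 0 < γ₀) :
    EndForcedLU (fun j : ℕ => (j : ℝ)) rlo rhi γ₀ ∧
      ∀ (β : HBeta) (Sβ : B12Beta.OneLoopSplit β), (∀ j, Sβ.β0 j = (j : ℝ)) → RemainderLU Sβ γ₀ rlo rhi →
        ∀ β' : ℝ, ¬ BetaUpperH β' γ₀ β := by
  refine ⟨endForcedLU_nat rhi hγ₀, fun β Sβ hb hrem β' hup => nat_not_bddAbove ?_⟩
  obtain ⟨B, hB⟩ := bddAbove_of_betaUpperH_lower Sβ hγ₀ hup fun k p hp => (hrem k p hp).1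
  exact ⟨B, fun j => (hb j).symm.le.trans (hB j)⟩

/-- **(UP) ⟂ E, SECOND HALF** · the constant one-loop sequence `b ≡ c` with `c < −rhi` (nonempty box): (UP) (`β′ := c + rhi`) for EVERY realization,
E for NO realization, whatever `rlo` (kernel §13e `Up_all_End_none_const`). [cite: Balaban1987RG1, Thm 2 p.259 (first sentence) and §1 p.264] -/
theorem betaUpperH_all_endPossible_none_const {c rlo rhi γ₀ : ℝ} (hγ₀ : 0 < γ₀) (hlt : c < -rhi) :
    (∀ (β : HBeta) (Sβ : B12Beta.OneLoopSplit β), (∀ j, Sβ.β0 j = c) → RemainderLU Sβ γ₀ rlo rhi →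
        BetaUpperH (c + rhi) γ₀ β) ∧
      ¬ EndPossibleLU (fun _ => c) rlo rhi γ₀ :=
  ⟨fun β Sβ hb hrem => betaUpperH_of_bddAbove_upper Sβ (fun j => (hb j).le) fun k p hp => (hrem k p hp).2, fun h => by
    have h' := (dwSeq_const_iff c (-rhi)).mp (dwSeq_neg_of_endPossibleLU hγ₀ h)
    linarith⟩

/-! ## §3 Readings: constant and convergent one-loop parts — strict thresholds; the boundary is not a function of the limit
(kernel §12a ∕ §12c ∕ §14f, ported one-sided) -/

/-- READING (constant one-loop part `b ≡ c`, nonempty box) · FORCED over `[−rlo, rhi]` ⟺ `rlo ≤ c` (kernel §12c `EndForcedLU_const_iff`). [folklore] -/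
theorem endForcedLU_const_iff (c : ℝ) {rlo rhi γ₀ : ℝ} (hγ₀ : 0 < γ₀) (hc : -rlo ≤ rhi) :
    EndForcedLU (fun _ => c) rlo rhi γ₀ ↔ rlo ≤ c := by
  rw [endForcedLU_iff_dwSeq hγ₀ hc, dwSeq_const_iff]

/-- READING (constant one-loop part) · POSSIBLE over `[−rlo, rhi]` ⟺ `−rhi ≤ c`.  With `endForcedLU_const_iff`: the undecided band is `−rhi ≤ c < rlo`
(kernel §12c `EndPossibleLU_const_iff`). [folklore] -/
theorem endPossibleLU_const_iff (c : ℝ) {rlo rhi γ₀ : ℝ} (hγ₀ : 0 < γ₀) (hc : -rlo ≤ rhi) :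
    EndPossibleLU (fun _ => c) rlo rhi γ₀ ↔ -rhi ≤ c := by
  rw [endPossibleLU_iff_dwSeq_neg hγ₀ hc, dwSeq_const_iff]

/-- READING (convergent one-loop part `b_j → L`) · `rlo < L` ⟹ FORCED, whatever `rhi` (kernel §12c `EndForcedLU_of_tendsto_lt`).
[cite: Balaban1987RG1, Thm 2 p.259 (first sentence) and (1.22) p.264] -/
theorem endForcedLU_of_tendsto_lt {b : ℕ → ℝ} {L rlo γ₀ : ℝ} (rhi : ℝ) (hγ₀ : 0 < γ₀) (hb : Tendsto b atTop (𝓝 L)) (h : rlo < L) :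
    EndForcedLU b rlo rhi γ₀ :=
  endForcedLU_of_dwSeq rhi hγ₀ (dwSeq_of_tendsto_lt hb h)

/-- READING (convergent one-loop part) · `L < rlo` ⟹ NOT FORCED (nonempty box): the adversarial realization has no E
(kernel §12c `not_EndForcedLU_of_tendsto_gt`). [cite: Balaban1987RG1, Thm 2 p.259 (first sentence) and (1.22) p.264] -/
theorem not_endForcedLU_of_tendsto_gt {b : ℕ → ℝ} {L rlo rhi γ₀ : ℝ} (hc : -rlo ≤ rhi) (hb : Tendsto b atTop (𝓝 L))
    (h : L < rlo) : ¬ EndForcedLU b rlo rhi γ₀ :=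
  fun hF => not_dwSeq_of_tendsto_gt hb h (dwSeq_of_endForcedLU hc hF)

/-- READING (convergent one-loop part) · `−rhi < L` ⟹ POSSIBLE (nonempty box) — in particular for every `rhi ≥ 0` as soon as `0 < L`
(kernel §12a `EndPossible_of_tendsto_gt_neg`, one-sided). [cite: Balaban1987RG1, Thm 2 p.259 (first sentence) and (1.22) p.264] -/
theorem endPossibleLU_of_tendsto_gt_neg {b : ℕ → ℝ} {L rlo rhi γ₀ : ℝ} (hγ₀ : 0 < γ₀) (hc : -rlo ≤ rhi)
    (hb : Tendsto b atTop (𝓝 L)) (h : -rhi < L) : EndPossibleLU b rlo rhi γ₀ :=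
  endPossibleLU_of_dwSeq_neg hγ₀ hc (dwSeq_of_tendsto_lt hb h)

/-- READING (convergent one-loop part) · `L < −rhi` ⟹ IMPOSSIBLE: no realization in the class has E (kernel §12a `not_EndPossible_of_tendsto_lt_neg`,
one-sided). [cite: Balaban1987RG1, Thm 2 p.259 (first sentence) and (1.22) p.264] -/
theorem not_endPossibleLU_of_tendsto_lt_neg {b : ℕ → ℝ} {L rlo rhi γ₀ : ℝ} (hγ₀ : 0 < γ₀) (hb : Tendsto b atTop (𝓝 L))
    (h : L < -rhi) : ¬ EndPossibleLU b rlo rhi γ₀ :=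
  fun hp => not_dwSeq_of_tendsto_gt hb h (dwSeq_neg_of_endPossibleLU hγ₀ hp)

/-- **AT THE BOUNDARY, FORCED IS NOT A FUNCTION OF THE LIMIT** · two one-loop parts with the SAME limit `L` (both convergent; nonempty box `−L ≤ rhi`),
E forced over `[−L, rhi]` for one (`L + 1∕(j+1)`) and not for the other (`L − 1∕(j+1)`, harmonic divergence of the drawdown): CONVERGENCE alone
leaves the boundary `rlo = L` undecided; a drift class closes it (`EndBandDriftClass`) (kernel §14f `boundary_undecided_by_limit`).
[cite: Balaban1987RG1, Thm 2 p.259 (first sentence) and (1.22) p.264] -/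
theorem boundary_undecided_by_limit {L rhi γ₀ : ℝ} (hγ₀ : 0 < γ₀) (hc : -L ≤ rhi) :
    ∃ b b' : ℕ → ℝ, Tendsto b atTop (𝓝 L) ∧ Tendsto b' atTop (𝓝 L) ∧ EndForcedLU b L rhi γ₀ ∧ ¬ EndForcedLU b' L rhi γ₀ :=
  ⟨_, _, tendsto_harmonicAbove L, tendsto_harmonicBelow L, endForcedLU_of_dwSeq rhi hγ₀ (dwSeq_harmonicAbove L),
    fun h => not_dwSeq_harmonicBelow L (dwSeq_of_endForcedLU hc h)⟩

end

end Summit.QuantumFields.BalabanUV.Gaps.EndBandStructure
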